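import Literature.NumberTheory.LFunctions.ZetaUniversalityDisc
import Literature.NumberTheory.LFunctions.EulerProductDenseness
import Literature.NumberTheory.LFunctions.ZetaEulerProductMeanSquareUniform
import Literature.NumberTheory.LFunctions.ZetaUniversalityDiscTools
import Literature.NumberTheory.LFunctions.ZetaUniversalityDiscTorus
import HarnessLib

/-!
# Voronin's universality theorem on discs — the assembly

Topic `Literature/NumberTheory/LFunctions`. Everything in this file is PROVED. It assembles
`Literature.NumberTheory.LFunctions.Steuding2007_thm1_9_discAnalytic` (universality of `ζ` on closed
discs `|s − c| ≤ ρ` in `1/2 < Re s < 1` for targets analytic on a larger disc and zero-free on the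
closed disc, with positive lower density of the shifts; Steuding, *Value-Distribution of
L-Functions*, Thm. 1.9 for discs = Voronin 1975) from the two named facts

* `Literature.NumberTheory.LFunctions.twistedEulerProduct_dense_disc` (denseness of twisted finite
  Euler products, Bayart–Matheron Cor. 11.17; `EulerProductDenseness.lean`), and
* `Literature.NumberTheory.LFunctions.zeta_sub_finiteEulerProduct_meanSquare_uniform` (Bohr's
  mean-square approximation of `ζ` by finite Euler products, locally uniformly in `σ`;
  `ZetaEulerProductMeanSquareUniform.lean`),

together with the Kronecker–Weyl equidistribution theorem PROVED in the tree
(`Literature.NumberTheory.DiophantineApproximation.KroneckerWeyl.tendsto_avg_integral_comp_flow_real`).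
The architecture is Voronin's (Steuding §1.3, (1.22)–(1.26); Bayart–Matheron §11.7, proof of
Thm. 11.2 and of Voronin's theorem from Thms. 11.1, 11.2), run — exactly as the tree's proof of the
Bohr–Courant theorem (`Literature/Barriers/RiemannHypothesis/BohrDenseValuesProofs.lean`) — with the
first-order tail sum instead of logarithms:

1. **steering** — phases `ϑ_p` (`p < N`, `N` beyond any cut-off) with
   `|g(s) − ∏_{p<N}(1 − p^{−s}e(ϑ_p))⁻¹| < ε/8` on the disc (the denseness fact), and a continuity
   radius `r` of the steering product on the fixed torus `(ℝ/ℤ)^{primes<N}`, uniform in `s`;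
2. **tail** — for `N ≤ q < P` the product `Q(s,θ) = ∏ (1 − q^{−s}e(θ_q))⁻¹` is within
   `2(|L(s,θ)| + Σ q^{−2σ})` of `1`, `L(s,θ) = Σ q^{−s}e(θ_q)`, and the circle mean square of `L`
   has torus average `≤ 2π (Σ_{q≥N} q^{−2σ₁}) ∫φ` against weights `φ` in the other variables;
3. **mean square** — `∫₀ᵀ |ζ − ζ_P|²(σ + i(t+a)) dt ≤ ε' T` uniformly for `σ` on the circle
   `|s − c| = ρ'` (the mean-square fact), hence (Fubini) for the circle mean square;
4. **Kronecker–Weyl** for the weight `φ` (a bump around `(ϑ_p)_{p<N}` in the coordinates `p < N`)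
   and for `φ ·` (circle mean square of `L`);
5. suprema over `|s − c| ≤ ρ` are dominated by circle mean squares over `|s − c| = ρ'` (Cauchy's
   formula, `VoroninTools.norm_sq_le_mul_integral_norm_sq_circle`), and the set of good shifts
   `t ∈ [0, T]` has measure `≥ ∫₀ᵀ φ(flow t)(1 − Λ(t)/d − E(t)/e) dt ≥ (c₁/4) T`.

## Main results

* `Steuding2007_thm1_9_discAnalytic_of_facts :
    twistedEulerProduct_dense_disc → zeta_sub_finiteEulerProduct_meanSquare_uniform →
    Steuding2007_thm1_9_discAnalytic`.

## References

* [Steuding2007] J. Steuding, *Value-Distribution of L-Functions*, LNM 1877, Springer 2007, §1.3,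
  Thm. 1.7, (1.17)–(1.26), Thm. 1.9.
* [BayartMatheron2009] F. Bayart, É. Matheron, *Dynamics of Linear Operators*, CUP 2009, Ch. 11,
  Thms. 11.1, 11.2, Lemma 11.3, §11.7.
-/

noncomputable section

open Complex Filter Set Metric MeasureTheory Topology
open scoped Real

namespace Literature.NumberTheory.LFunctions

namespace VoroninAssembly

open VoroninTools VoroninTorus Literature.NumberTheory.DiophantineApproximation
open Literature.Barriers.RiemannHypothesis.ShiftsOnDiscs (integral_interval_interval_swap)

/-! ### The pointwise conclusion at a good shift -/

/-- **The three-epsilon step at a good shift.** On the torus `(ℝ/ℤ)^{primes<P}` let `Z(s,θ)` be the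
steering product over `p < N`, `Q(s,θ)` the tail product and `L(s,θ)` the tail sum over
`N ≤ q < P` (`N ≥ 4`). If at the torus point `θ` and the shift `t`: `Z(s,θ)` is within `ε/4` of
`g(s)` and `|g| ≤ M` on the disc, `|L(s,θ)| < δ₁`, `Σ q^{-2 Re s} ≤ δ₁ ≤ 1/32`, `(M+1)·4δ₁ ≤ ε/4`,
`ε ≤ 1`, `ζ(s+it)` is within `ε/4` of the full product `∏_{p<P}(1 − p^{−s−it})⁻¹ = Z(s,θ)Q(s,θ)`,
then `|ζ(s+it) − g(s)| < ε` on the disc. [cite: Steuding2007, §1.3 (1.26) and sequel] -/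
theorem norm_zeta_sub_lt_of_good {P N : ℕ} (hN : 4 ≤ N) {c : ℂ} {ρ : ℝ} (hσ : 1 / 2 < c.re - ρ)
    (θ : UnitAddTorus ↥(P.primesBelow)) (t : ℝ) {g : ℂ → ℂ} {Z : ℂ → ℂ} {M δ₁ ε : ℝ}
    (hε1 : ε ≤ 1) (hδ₁ : δ₁ ≤ 1 / 32) (hKδ : (M + 1) * (4 * δ₁) ≤ ε / 4)
    (hM : ∀ s ∈ closedBall c ρ, ‖g s‖ ≤ M)
    (hZg : ∀ s ∈ closedBall c ρ, ‖Z s - g s‖ < ε / 4)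
    (hL : ∀ s ∈ closedBall c ρ, ‖∑ q ∈ (Finset.univ : Finset ↥(P.primesBelow)).filter
      (fun q ↦ N ≤ q.1), (q.1 : ℂ) ^ (-s) * fourier 1 (θ q)‖ < δ₁)
    (htail : ∀ s ∈ closedBall c ρ, ∑ q ∈ (Finset.univ : Finset ↥(P.primesBelow)).filter
      (fun q ↦ N ≤ q.1), ((q.1 : ℝ) ^ (-s.re)) ^ 2 ≤ δ₁)
    (hZP : ∀ s : ℂ, ∏ p ∈ P.primesBelow, (1 - (p : ℂ) ^ (-(s + t * I)))⁻¹ =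
      Z s * ∏ q ∈ (Finset.univ : Finset ↥(P.primesBelow)).filter (fun q ↦ N ≤ q.1),
        (1 - (q.1 : ℂ) ^ (-s) * fourier 1 (θ q))⁻¹)
    (hEz : ∀ s ∈ closedBall c ρ, ‖riemannZeta (s + t * I) -
      ∏ p ∈ P.primesBelow, (1 - (p : ℂ) ^ (-(s + t * I)))⁻¹‖ < ε / 4) :
    ∀ s ∈ closedBall c ρ, ‖riemannZeta (s + t * I) - g s‖ < ε := by
  intro s hs
  have hsre : 1 / 2 < s.re := by
    have h1 : ‖s - c‖ ≤ ρ := by rwa [mem_closedBall, dist_eq_norm] at hs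
    have h2 : |(s - c).re| ≤ ‖s - c‖ := Complex.abs_re_le_norm _
    rw [sub_re] at h2
    have := (abs_le.1 (h2.trans h1)).1
    linarith
  set Q : ℂ := ∏ q ∈ (Finset.univ : Finset ↥(P.primesBelow)).filter (fun q ↦ N ≤ q.1),
    (1 - (q.1 : ℂ) ^ (-s) * fourier 1 (θ q))⁻¹ with hQ
  -- the tail product is within `4δ₁` of `1`
  have hδ₁0 : 0 ≤ δ₁ := by
    have := hL s hs
    exact (norm_nonneg _).trans this.le
  have hQ1 : ‖Q - 1‖ ≤ 4 * δ₁ := by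
    have hsmall : ‖∑ q ∈ (Finset.univ : Finset ↥(P.primesBelow)).filter (fun q ↦ N ≤ q.1),
        (q.1 : ℂ) ^ (-s) * fourier 1 (θ q)‖ +
        ∑ q ∈ (Finset.univ : Finset ↥(P.primesBelow)).filter (fun q ↦ N ≤ q.1),
          ((q.1 : ℝ) ^ (-s.re)) ^ 2 ≤ 1 := by
      linarith [hL s hs, htail s hs]
    have h := norm_tailProduct_sub_one_le (P := P) hN hsre θ hsmall
    rw [← hQ] at h
    linarith [hL s hs, htail s hs]
  -- combine
  have hZnorm : ‖Z s‖ ≤ M + 1 := by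
    have h1 := norm_le_insert' (Z s) (g s)
    have h2 := hM s hs
    have h3 := hZg s hs
    linarith
  have hM0 : 0 ≤ M := (norm_nonneg _).trans (hM s hs)
  have hmid : ‖Z s * Q - Z s‖ ≤ ε / 4 := by
    rw [← mul_sub_one, norm_mul]
    calc ‖Z s‖ * ‖Q - 1‖ ≤ (M + 1) * (4 * δ₁) :=
          mul_le_mul hZnorm hQ1 (norm_nonneg _) (by linarith)
      _ ≤ ε / 4 := hKδ
  have hEz' : ‖riemannZeta (s + t * I) - Z s * Q‖ < ε / 4 := by
    have := hEz s hs
    rwa [hZP s] at this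
  have hε0 : 0 < ε := by
    have := hZg s hs
    linarith [norm_nonneg (Z s - g s)]
  calc ‖riemannZeta (s + t * I) - g s‖
      = ‖(riemannZeta (s + t * I) - Z s * Q) + (Z s * Q - Z s) + (Z s - g s)‖ := by ring_nf
    _ ≤ ‖riemannZeta (s + t * I) - Z s * Q‖ + ‖Z s * Q - Z s‖ + ‖Z s - g s‖ := norm_add₃_le
    _ < ε / 4 + ε / 4 + ε / 4 := by linarith [hZg s hs]
    _ < ε := by linarith

/-! ### Transfers from circle mean squares to the disc -/

/-- The tail sum `s ↦ L(s, θ)` is entire, so its supremum on `|s − c| ≤ ρ` is controlled by its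
mean square on the circle `|s − c| = ρ'`. [cite: Steuding2007, §1.3 (1.26)] -/
theorem norm_sq_firstOrderSum_le {P : ℕ} (S : Finset ↥(P.primesBelow)) {c : ℂ} {ρ ρ' : ℝ}
    (hρ : 0 ≤ ρ) (hρρ' : ρ < ρ') (θ : UnitAddTorus ↥(P.primesBelow)) {s : ℂ}
    (hs : s ∈ closedBall c ρ) :
    ‖∑ q ∈ S, (q.1 : ℂ) ^ (-s) * fourier 1 (θ q)‖ ^ 2 ≤ ρ' ^ 2 / (2 * π * (ρ' - ρ) ^ 2) *
      ∫ α in (0 : ℝ)..2 * π, ‖∑ q ∈ S, (q.1 : ℂ) ^ (-circleMap c ρ' α) * fourier 1 (θ q)‖ ^ 2 := by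
  have hd : Differentiable ℂ fun z : ℂ ↦ ∑ q ∈ S, (q.1 : ℂ) ^ (-z) * fourier 1 (θ q) := by
    refine Differentiable.fun_sum fun q _ ↦ ?_  -- each term `q^{-z} e(θ_q)`
    have hq : (q.1 : ℂ) ≠ 0 := by exact_mod_cast (Nat.prime_of_mem_primesBelow q.2).ne_zero
    exact (differentiable_id.neg.const_cpow (Or.inl hq)).mul_const _
  exact norm_sq_le_mul_integral_norm_sq_circle hρ hρρ' hd.diffContOnCl hs

/-- `ζ(z) − ∏_{p<P}(1 − p^{−z})⁻¹` is holomorphic on the open strip `1/2 < Re z < 1` (indeed on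
`0 < Re z`, `z ≠ 1`). [folklore] -/
theorem differentiableOn_zeta_sub_eulerProduct_strip (P : ℕ) :
    DifferentiableOn ℂ (fun z ↦ riemannZeta z - ∏ p ∈ P.primesBelow, (1 - (p : ℂ) ^ (-z))⁻¹)
      {z : ℂ | 1 / 2 < z.re ∧ z.re < 1} := by
  intro z hz
  have hne : z ≠ 1 := by intro h; rw [h] at hz; norm_num at hz
  refine DifferentiableAt.differentiableWithinAt (DifferentiableAt.sub ?_ ?_)
  · exact differentiableAt_riemannZeta hne
  · refine DifferentiableAt.fun_finsetProd fun p hp ↦ DifferentiableAt.inv ?_ ?_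
    · have hp0 : (p : ℂ) ≠ 0 := by exact_mod_cast (Nat.prime_of_mem_primesBelow hp).ne_zero
      exact (differentiableAt_const _).sub (differentiableAt_id.neg.const_cpow (Or.inl hp0))
    · intro h
      have hp := Nat.prime_of_mem_primesBelow hp
      have hn : ‖(p : ℂ) ^ (-z)‖ < 1 := by
        rw [Complex.norm_natCast_cpow_of_pos hp.pos, neg_re]
        exact Real.rpow_lt_one_of_one_lt_of_neg (by exact_mod_cast hp.one_lt) (by linarith [hz.1])
      rw [sub_eq_zero] at h
      rw [← h, norm_one] at hn
      exact lt_irrefl _ hn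

/-- Real parts on a closed disc: `|Re z − Re c| ≤ ρ'` for `|z − c| ≤ ρ'`. [folklore] -/
theorem abs_re_sub_re_le_of_mem_closedBall {c z : ℂ} {ρ' : ℝ} (hz : z ∈ closedBall c ρ') :
    |z.re - c.re| ≤ ρ' := by
  have hz1 : ‖z - c‖ ≤ ρ' := by rwa [mem_closedBall, dist_eq_norm] at hz
  have hz2 : |(z - c).re| ≤ ‖z - c‖ := Complex.abs_re_le_norm _
  rw [sub_re] at hz2
  exact hz2.trans hz1

/-- `ζ(z + it) − ∏_{p<P}(1 − p^{−z−it})⁻¹` is holomorphic on every closed disc `|z − c| ≤ ρ'`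
contained in `1/2 < Re z < 1`. [folklore] -/
theorem differentiableOn_zeta_sub_eulerProduct {c : ℂ} {ρ' : ℝ} (h1 : 1 / 2 < c.re - ρ')
    (h2 : c.re + ρ' < 1) (P : ℕ) (t : ℝ) :
    DifferentiableOn ℂ (fun z ↦ riemannZeta (z + t * I) -
      ∏ p ∈ P.primesBelow, (1 - (p : ℂ) ^ (-(z + t * I)))⁻¹) (closedBall c ρ') := by
  have hmaps : MapsTo (fun z : ℂ ↦ z + t * I) (closedBall c ρ') {z : ℂ | 1 / 2 < z.re ∧ z.re < 1} := by
    intro z hz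
    obtain ⟨ha, hb⟩ := abs_le.1 (abs_re_sub_re_le_of_mem_closedBall hz)
    simp only [mem_setOf_eq, add_re, mul_I_re, ofReal_im, neg_zero, add_zero]
    exact ⟨by linarith, by linarith⟩
  exact (differentiableOn_zeta_sub_eulerProduct_strip P).comp
    ((differentiable_id.add_const _).differentiableOn) hmaps

/-- Hence its supremum on `|s − c| ≤ ρ` is controlled by its mean square on `|s − c| = ρ'`
(`ρ < ρ'`). [cite: Steuding2007, §1.3 (1.21)] -/
theorem norm_sq_zeta_sub_eulerProduct_le {c : ℂ} {ρ ρ' : ℝ} (hρ : 0 ≤ ρ) (hρρ' : ρ < ρ')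
    (h1 : 1 / 2 < c.re - ρ') (h2 : c.re + ρ' < 1) (P : ℕ) (t : ℝ) {s : ℂ}
    (hs : s ∈ closedBall c ρ) :
    ‖riemannZeta (s + t * I) - ∏ p ∈ P.primesBelow, (1 - (p : ℂ) ^ (-(s + t * I)))⁻¹‖ ^ 2 ≤
      ρ' ^ 2 / (2 * π * (ρ' - ρ) ^ 2) * ∫ α in (0 : ℝ)..2 * π,
        ‖riemannZeta (circleMap c ρ' α + t * I) -
          ∏ p ∈ P.primesBelow, (1 - (p : ℂ) ^ (-(circleMap c ρ' α + t * I)))⁻¹‖ ^ 2 := by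
  have hd := (differentiableOn_zeta_sub_eulerProduct h1 h2 P t).mono
    (closure_ball_subset_closedBall : closure (ball c ρ') ⊆ closedBall c ρ')
  exact norm_sq_le_mul_integral_norm_sq_circle hρ hρρ' hd.diffContOnCl hs

/-- The integrand of the circle mean square of `ζ − ζ_P` is jointly continuous in the shift `t`
and the circle parameter `α` (the circle stays inside `1/2 < Re < 1`, away from the pole).
[folklore] -/
theorem continuous_zeta_sub_eulerProduct_circle {c : ℂ} {ρ' : ℝ} (hρ' : 0 ≤ ρ')
    (h1 : 1 / 2 < c.re - ρ') (h2 : c.re + ρ' < 1) (P : ℕ) :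
    Continuous (Function.uncurry fun (t α : ℝ) ↦ ‖riemannZeta (circleMap c ρ' α + t * I) -
      ∏ p ∈ P.primesBelow, (1 - (p : ℂ) ^ (-(circleMap c ρ' α + t * I)))⁻¹‖ ^ 2) := by
  have hcont := (differentiableOn_zeta_sub_eulerProduct_strip P).continuousOn
  have hmap : Continuous fun p : ℝ × ℝ ↦ circleMap c ρ' p.2 + p.1 * I :=
    ((continuous_circleMap c ρ').comp continuous_snd).add
      ((Complex.continuous_ofReal.comp continuous_fst).mul continuous_const)
  have hin : ∀ p : ℝ × ℝ, circleMap c ρ' p.2 + p.1 * I ∈ {z : ℂ | 1 / 2 < z.re ∧ z.re < 1} := by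
    intro p
    have hz : circleMap c ρ' p.2 ∈ closedBall c ρ' :=
      sphere_subset_closedBall (circleMap_mem_sphere c hρ' p.2)
    obtain ⟨ha, hb⟩ := abs_le.1 (abs_re_sub_re_le_of_mem_closedBall hz)
    simp only [mem_setOf_eq, add_re, mul_I_re, ofReal_im, neg_zero, add_zero]
    exact ⟨by linarith, by linarith⟩
  have h := hcont.comp_continuous hmap hin
  exact (continuous_norm.comp h).pow 2

/-! ### The circle mean square of `ζ − ζ_P` in the mean over `[0, T]` -/

/-- **The mean-square input on the circle.** If for every point `α` of the circle the shift mean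
square `∫₀ᵀ F(t, α) dt` is at most `ε' T`, then `∫₀ᵀ ∫₀^{2π} F(t, α) dα dt ≤ 2π ε' T`. [folklore] -/
theorem integral_circleMeanSquare_le {F : ℝ → ℝ → ℝ} (hF : Continuous (Function.uncurry F))
    {T ε' : ℝ} (hT : 0 ≤ T) (hb : ∀ α ∈ Icc (0 : ℝ) (2 * π), ∫ t in (0 : ℝ)..T, F t α ≤ ε' * T) :
    ∫ t in (0 : ℝ)..T, ∫ α in (0 : ℝ)..2 * π, F t α ≤ 2 * π * ε' * T := by
  rw [integral_interval_interval_swap hF hT (by positivity)]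
  have hF' : Continuous (Function.uncurry fun (α t : ℝ) ↦ F t α) := hF.comp continuous_swap
  have hcont : Continuous fun α : ℝ ↦ ∫ t in (0 : ℝ)..T, F t α :=
    intervalIntegral.continuous_parametric_intervalIntegral_of_continuous' hF' _ _
  calc ∫ α in (0 : ℝ)..2 * π, ∫ t in (0 : ℝ)..T, F t α ≤ ∫ α in (0 : ℝ)..2 * π, ε' * T :=
        intervalIntegral.integral_mono_on (by positivity) (hcont.intervalIntegrable _ _)
          intervalIntegrable_const hb
    _ = 2 * π * ε' * T := by rw [intervalIntegral.integral_const, smul_eq_mul]; ring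

end VoroninAssembly

end Literature.NumberTheory.LFunctions
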